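import Summits.HodgeConjecture.HodgeConjecture.Theses.BoundaryReadout
import Literature.AlgebraicGeometry.HodgeTheory.HodgeTypeProjectors
import Literature.AlgebraicGeometry.HodgeTheory.HodgeTypeExteriorProduct
import Literature.AlgebraicGeometry.HodgeTheory.HodgeTypeConjugation
import HarnessLib

/-!
# Route `BoundaryReadout` — crux `BoundaryAbsoluteness` (stmt-HodgeConjecture-15913), line
# `typewise_readout`, stub `stub_typeDescent`: Hodge type descends along a kernel inclusion

Helper file for the crux item stmt-HodgeConjecture-15913 (`--supports`; it closes nothing): it proves
the registered stub `stub_typeDescent` (THE LEVER of the line) of the skeleton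
`Cruxes/BoundaryAbsoluteness/Lines/typewise_readout.lean`, verbatim:

> on ONE smooth projective `X / ℂ`, given finitely many `h_i : Y_i ⟶ X` and `w : W ⟶ X` (all smooth
> projective) with `⋂ᵢ ker h_i^* ⊆ ker w^*` on `Hᵏ(X(ℂ); ℂ)`, a complex class `Θ ∈ Hᵏ(X(ℂ); ℂ)` all of
> whose pull-backs `h_i^* Θ` are of Hodge type `(a, b)` has `w^* Θ` of Hodge type `(a, b)`.

It is `σ`-free, curve-free `ℂ`-linear Hodge theory (Voisin I, Thm. 6.18, §7.1.1, §7.3.2); no named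
fact is used (Hodge models exist, `nonempty_hodgeModel_holds`; the Hodge pieces do not depend on the
model, `hodgePQ_independent_of_hodgeModel_holds` — both PROVED in the tree).

## Proof

Take a Hodge model `A` of `X` and its type projectors `π_{(p,q)} = A.typeProj k (p, q)`,
`p + q = k` (`HodgeModel.sum_typeProj`: `Θ = ∑ π_{(p,q)} Θ`; each summand is of type `(p, q)`,
`HodgeModel.typeProj_mem`).

* If `a + b ≠ k`, a class of type `(a, b)` in degree `k` is `0` (the piece `H^{a,b} ⊆ Hᵏ` of a model
  is `⊥` off the antidiagonal, `hodgePQ_eq_bot_of_ne`, and the pull-back to the model is injective):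
  all `h_i^* Θ = 0`, so `w^* Θ = 0` by the kernel inclusion, and `0` is of every type on `W`
  (`IsOfHodgeType.zero` with a Hodge model of `W`).
* If `a + b = k`: on each `Y_i` (Hodge model `A_i`) the classes `h_i^*(π_{(p,q)} Θ)` are of type
  `(p, q)` (pull-backs preserve types, `IsOfHodgeType.map_of_isSmoothProjective`) and sum to
  `h_i^* Θ`, so by uniqueness of the type decomposition (`HodgeModel.typeProj_eq_of_sum_eq`)
  `h_i^*(π_{(a,b)} Θ) = π^{A_i}_{(a,b)}(h_i^* Θ) = h_i^* Θ`, the last because `h_i^* Θ` is of type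
  `(a, b)` by hypothesis (`HodgeModel.typeProj_apply_of_mem`). Hence `h_i^*(Θ - π_{(a,b)} Θ) = 0` for
  all `i`, so `w^*(Θ - π_{(a,b)} Θ) = 0` by the kernel inclusion, i.e. `w^* Θ = w^*(π_{(a,b)} Θ)`,
  which is of type `(a, b)` on `W` (pull-backs preserve types).

NOT claimed (false in general): that `Θ` itself is of type `(a, b)` on `X`.

## Main result

* `stub_typeDescent` — the registered stub (name and signature verbatim), PROVED (standard axioms).

## References

* C. Voisin, *Hodge Theory and Complex Algebraic Geometry I*, CUP 2002, Thm. 6.18 (Hodge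
  decomposition), Cor. 6.14, §7.1.1 (the `H^{p,q}(X) ⊆ Hᵏ(X, ℂ)`), §7.3.2 (`φ^*` is a morphism of
  Hodge structures). [VoisinHodgeI2002]
-/

-- every declaration of this problem lives in `Summit.HodgeConjecture.HodgeConjecture.…`
-- (single-problem summit: Problem = Summit), which `linter.dupNamespace` flags; set so that
-- stand-alone elaboration is warning-free.
set_option linter.dupNamespace false

noncomputable section

namespace Summit.HodgeConjecture.HodgeConjecture.Theorems

open CategoryTheory AlgebraicGeometry
open Literature.AlgebraicGeometry.Motives Literature.AlgebraicGeometry.HodgeTheory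

namespace BoundaryAbsolutenessTypeDescent

variable {n : ℕ} {X : SchemeOver ℂ}

/-- **A class of Hodge type `(p, q)` in degree `k ≠ p + q` is zero**: the piece `H^{p,q} ⊆ Hᵏ(X^an)`
of a Hodge model is `⊥` off the antidiagonal (there are no `k`-forms of type `(p, q)`,
`hodgePQ_eq_bot_of_ne`) and the pull-back `Hᵏ(X(ℂ); ℂ) → Hᵏ(X^an; ℂ)` is injective. (The first
`by_cases` branch of the tree's `IsOfHodgeType.eq_zero_of_ne`, isolated; no smoothness needed.)
[cite: VoisinHodgeI2002, Cor. 6.14 and §7.1.1] -/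
theorem eq_zero_of_isOfHodgeType_of_add_ne {k p q : ℕ} {c : complexBetti X k}
    (hc : IsOfHodgeType n X k p q c) (hpq : p + q ≠ k) : c = 0 := by
  obtain ⟨A, hA⟩ := hc
  have hbot : A.hodgePQ k p q = ⊥ :=
    (A.hodgePQ_eq_bot_iff k p q).2
      (Literature.NumberTheory.Transcendental.hodgePQ_eq_bot_of_ne (M := A.carrier) hpq)
  rw [hbot, Submodule.mem_bot] at hA
  exact A.pullback_injective k (by rw [hA, map_zero])

/-- **Pull-back commutes with the type projectors** (Voisin I §7.3.2: `f^*` is a morphism of Hodge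
structures, i.e. respects the bigrading): for a morphism `f : Y ⟶ X` of smooth projective varieties,
Hodge models `A` of `X` and `B` of `Y`, and every `c ∈ Hᵏ(X(ℂ); ℂ)`,
`f^*(π^A_{(p,q)} c) = π^B_{(p,q)}(f^* c)` — the classes `f^*(π^A_{(p',q')} c)` are of type `(p', q')`
on `Y` (`IsOfHodgeType.map_of_isSmoothProjective`) and sum to `f^* c`, and the type decomposition on
`Y` is unique (`HodgeModel.typeProj_eq_of_sum_eq`). [cite: VoisinHodgeI2002, Thm. 6.18 and §7.3.2] -/
theorem map_typeProj {m : ℕ} {Y : SchemeOver ℂ} (hY : IsSmoothProjective m Y)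
    (hX : IsSmoothProjective n X) (f : Y ⟶ X) (A : HodgeModel n X) (B : HodgeModel m Y) {k : ℕ}
    (pq : ↥(Finset.HasAntidiagonal.antidiagonal k)) (c : complexBetti X k) :
    complexBetti.map f k (A.typeProj k pq c) = B.typeProj k pq (complexBetti.map f k c) := by
  -- the decomposition of `f^* c` along the types, pulled back from `X`
  have hy : ∀ pq' : ↥(Finset.HasAntidiagonal.antidiagonal k),
      complexBetti.map f k (A.typeProj k pq' c) ∈ B.typePiece k pq' :=
    fun pq' ↦ (B.mem_typePiece_iff pq' _).2
      (((A.isOfHodgeType_of_mem_typePiece (A.typeProj_mem k pq' c)).map_of_isSmoothProjective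
        hY hX f).mem_hodgePQ hY B)
  have hsum : ∑ pq', complexBetti.map f k (A.typeProj k pq' c) = complexBetti.map f k c := by
    rw [← map_sum, A.sum_typeProj]
  exact (B.typeProj_eq_of_sum_eq
    (y := fun pq' ↦ complexBetti.map f k (A.typeProj k pq' c)) hy hsum pq).symm

/-- **On a piece where `f^* c` is of type `(a, b)`, the other type components of `c` die and the
`(a, b)`-component restricts to `f^* c`**: `f^*(π^A_{(a,b)} c) = f^* c` for `f : Y ⟶ X` a morphism of
smooth projective varieties and `f^* c` of Hodge type `(a, b)`, `a + b = k`.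
[cite: VoisinHodgeI2002, Thm. 6.18 and §7.3.2] -/
theorem map_typeProj_eq_map_of_isOfHodgeType {m : ℕ} {Y : SchemeOver ℂ} (hY : IsSmoothProjective m Y)
    (hX : IsSmoothProjective n X) (f : Y ⟶ X) (A : HodgeModel n X) {k a b : ℕ} (hab : a + b = k)
    {c : complexBetti X k} (hc : IsOfHodgeType m Y k a b (complexBetti.map f k c)) :
    complexBetti.map f k (A.typeProj k ⟨(a, b), Finset.HasAntidiagonal.mem_antidiagonal.2 hab⟩ c) =
      complexBetti.map f k c := by
  obtain ⟨B⟩ := nonempty_hodgeModel_holds hY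
  have hmem : complexBetti.map f k c ∈
      B.typePiece k ⟨(a, b), Finset.HasAntidiagonal.mem_antidiagonal.2 hab⟩ :=
    (B.mem_typePiece_iff _ _).2 (hc.mem_hodgePQ hY B)
  rw [map_typeProj hY hX f A B _ c, B.typeProj_apply_of_mem hmem]

end BoundaryAbsolutenessTypeDescent

open BoundaryAbsolutenessTypeDescent in
/-- **REGISTERED STUB `stub_typeDescent` (line `typewise_readout` of the crux `BoundaryAbsoluteness`,
THE LEVER) — Hodge type descends along a kernel inclusion.** On ONE smooth projective `X / ℂ`: for
finitely many `h_i : Y_i ⟶ X` and `w : W ⟶ X` (all smooth projective) with `⋂ᵢ ker h_i^* ⊆ ker w^*` on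
`Hᵏ(X(ℂ); ℂ)`, a complex class `Θ` all of whose pull-backs `h_i^* Θ` are of Hodge type `(a, b)` has
`w^* Θ` of Hodge type `(a, b)`. Proof: with a Hodge model `A` of `X` (`nonempty_hodgeModel_holds`),
if `a + b ≠ k` every `h_i^* Θ` is `0` (`eq_zero_of_isOfHodgeType_of_add_ne`), so `w^* Θ = 0` is of
every type; if `a + b = k` then `h_i^*(Θ - π_{(a,b)} Θ) = 0` for all `i`
(`map_typeProj_eq_map_of_isOfHodgeType`: pull-backs commute with the type projectors and `h_i^* Θ` is
its own `(a, b)`-component), hence `w^* Θ = w^*(π_{(a,b)} Θ)` by the kernel inclusion, of type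
`(a, b)` since pull-backs preserve types (`IsOfHodgeType.map_of_isSmoothProjective`). NOT claimed:
`Θ` of type `(a, b)` on `X`. [cite: VoisinHodgeI2002, Thm. 6.18, §7.1.1 and §7.3.2] -/
theorem stub_typeDescent :
    ∀ ⦃n : ℕ⦄ ⦃X : SchemeOver ℂ⦄, IsSmoothProjective n X →
      ∀ ⦃ι : Type⦄ [Finite ι] ⦃m : ι → ℕ⦄ ⦃Y : ι → SchemeOver ℂ⦄ (h : ∀ i, Y i ⟶ X),
        (∀ i, IsSmoothProjective (m i) (Y i)) →
        ∀ ⦃nW : ℕ⦄ ⦃W : SchemeOver ℂ⦄ (w : W ⟶ X), IsSmoothProjective nW W →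
          ∀ (k a b : ℕ), (∀ x : complexBetti X k,
              (∀ i, complexBetti.map (h i) k x = 0) → complexBetti.map w k x = 0) →
            ∀ (Θ : complexBetti X k),
              (∀ i, IsOfHodgeType (m i) (Y i) k a b (complexBetti.map (h i) k Θ)) →
              IsOfHodgeType nW W k a b (complexBetti.map w k Θ) := by
  intro n X hX ι _ m Y h hY nW W w hW k a b hker Θ hΘ
  -- Hodge models of `X` and `W` (PROVED existence)
  obtain ⟨A⟩ := nonempty_hodgeModel_holds hX
  obtain ⟨B⟩ := nonempty_hodgeModel_holds hW
  by_cases hab : a + b = k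
  swap
  · -- off the antidiagonal: every `h_i^* Θ` vanishes, hence so does `w^* Θ`
    have h0 : complexBetti.map w k Θ = 0 :=
      hker Θ fun i ↦ eq_zero_of_isOfHodgeType_of_add_ne (hΘ i) hab
    rw [h0]
    exact IsOfHodgeType.zero B k a b
  · -- on the antidiagonal: `w^* Θ = w^*(π_{(a,b)} Θ)`, `π_{(a,b)} Θ` the `(a, b)`-component of `Θ`
    have hmem := A.typeProj_mem k ⟨(a, b), Finset.HasAntidiagonal.mem_antidiagonal.2 hab⟩ Θ
    -- the `(a, b)`-component of `Θ` is of type `(a, b)` on `X`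
    have hΘab := A.isOfHodgeType_of_mem_typePiece hmem
    -- on each piece `h_i^*(π_{(a,b)} Θ) = h_i^* Θ`
    have hpiece : ∀ i,
        complexBetti.map (h i) k
            (A.typeProj k ⟨(a, b), Finset.HasAntidiagonal.mem_antidiagonal.2 hab⟩ Θ) =
          complexBetti.map (h i) k Θ :=
      fun i ↦ map_typeProj_eq_map_of_isOfHodgeType (hY i) hX (h i) A hab (hΘ i)
    -- kernel inclusion: `w^*(Θ - π_{(a,b)} Θ) = 0`
    have hdiff : complexBetti.map w k
        (Θ - A.typeProj k ⟨(a, b), Finset.HasAntidiagonal.mem_antidiagonal.2 hab⟩ Θ) = 0 :=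
      hker _ fun i ↦ by rw [map_sub, hpiece i, sub_self]
    rw [map_sub, sub_eq_zero] at hdiff
    rw [hdiff]
    -- pull-backs preserve types
    exact hΘab.map_of_isSmoothProjective hW hX w

end Summit.HodgeConjecture.HodgeConjecture.Theorems

end
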